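import Summits.KontsevichZagierPeriods.KontsevichZagierPeriods.Theses.SymplecticScissors

/-!
# `TransportToGroup` (stmt-KontsevichZagierPeriods-9850, route SymplecticScissors)

Null-set bookkeeping.

The support item `TransportToGroup` of route SymplecticScissors: if `s ⊆ r` and `s' ⊆ r'` are
full-measure `ℚ`-semialgebraic restrictions of two integrand-`1` representations `r, r'` (all four
with integrand `1` on their domains) and `[s] − [s']` is ONE change-of-variables generator of the
Kontsevich–Zagier calculus, then `[r] − [r']` lies in the *set-chain group*
`closure ((domainAddRel ∪ changeOfVariablesRel) ∩ closure {[t] : t integrand 1})`.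
This is the implication PlanarTransport ⟹ PlanarK0Injective of the route.

Proof (the item's informal text, pure bookkeeping with move (1a) of
[Kontsevich–Zagier 2001, §1.2]): with `N := r|(r.domain ∖ s.domain)`, an integrand-`1`
representation on a null set, `[r] − [s] − [N]` is a domain-additivity generator
(`r.domain = s.domain ∪ (r.domain ∖ s.domain)`, overlap `∅`); a representation `N` on a NULL domain
satisfies `[N] − [N] − [N] ∈ domainAddRel` (move (1a) with `N.domain = N.domain ∪ N.domain`, the
overlap `N.domain` being null), so `[N]` itself lies in the group; the same for `r'`; finally
`[r] − [r'] = ([r] − [s] − [N]) − ([r'] − [s'] − [N']) + ([s] − [s']) + [N] − [N']`.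
Everything is proved in every dimension `n` (`sub_mem_closure_of_transport`) and specialised to
`n = 2` for the route decl. No named facts, no new definitions.
-/

noncomputable section

open Set MeasureTheory
open Literature.NumberTheory.Transcendental

namespace Summit.KontsevichZagierPeriods.SymplecticScissors.TransportToGroup

open Summit.KontsevichZagierPeriods.KontsevichZagierPeriods.Theses.SymplecticScissors
  (TransportToGroup)

/-- **Null representations vanish in the set-chain group.** If `N` is an integral representation
on a Lebesgue-null domain and `[N]` lies in an additive subgroup `P` of the formal group, then
`[N] ∈ closure ((domainAddRel ∪ changeOfVariablesRel) ∩ P)`: move (1a) with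
`N.domain = N.domain ∪ N.domain` (overlap `N.domain`, null) gives the generator
`[N] − [N] − [N] = −[N]`. [Kontsevich–Zagier 2001, §1.2, rule (1)] -/
theorem of_mem_closure_of_volume_eq_zero {n : ℕ} (N : KZ.IntegralRep n)
    (hN : volume N.domain = 0) (P : AddSubgroup KZ.FormalRep) (hP : KZ.of N ∈ P) :
    KZ.of N ∈ AddSubgroup.closure
      ((KZ.domainAddRel ∪ KZ.changeOfVariablesRel) ∩ (P : Set KZ.FormalRep)) := by
  have h3 : KZ.of N - KZ.of N - KZ.of N ∈ KZ.domainAddRel :=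
    ⟨n, N, N, N, (union_self _).symm, by rwa [inter_self], fun _ _ => rfl, fun _ _ => rfl, rfl⟩
  have hG : KZ.of N - KZ.of N - KZ.of N ∈ AddSubgroup.closure
      ((KZ.domainAddRel ∪ KZ.changeOfVariablesRel) ∩ (P : Set KZ.FormalRep)) :=
    AddSubgroup.subset_closure ⟨Or.inl h3, P.sub_mem (P.sub_mem hP hP) hP⟩
  have hEq : KZ.of N - KZ.of N - KZ.of N = -KZ.of N := by abel
  rw [hEq] at hG
  exact neg_mem_iff.mp hG

/-- **Splitting off a subdomain is move (1a).** If `s.domain ⊆ r.domain` and the integrands of `r`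
and `s` agree on `s.domain`, then for any representation `N` with domain `r.domain ∖ s.domain` and
the integrand of `r`, `[r] − [s] − [N]` is a domain-additivity generator
(`r.domain = s.domain ∪ N.domain`, `s.domain ∩ N.domain = ∅`).
[Kontsevich–Zagier 2001, §1.2, rule (1)] -/
theorem of_sub_of_sub_of_mem_domainAddRel {n : ℕ} (r s N : KZ.IntegralRep n)
    (hsr : s.domain ⊆ r.domain) (heq : EqOn r.integrand s.integrand s.domain)
    (hNd : N.domain = r.domain \ s.domain) (hNi : N.integrand = r.integrand) :
    KZ.of r - KZ.of s - KZ.of N ∈ KZ.domainAddRel :=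
  ⟨n, r, s, N, by rw [hNd, Set.union_sdiff_cancel hsr],
    by rw [hNd, Set.inter_sdiff_self, measure_empty], heq, fun p _ => by rw [hNi], rfl⟩

/-- **Null-set bookkeeping in every dimension.** For integrand-`1` representations `r, r', s, s'`
of dimension `n` with `s.domain ⊆ r.domain`, `s'.domain ⊆ r'.domain` of full measure and
`[s] − [s'] ∈ changeOfVariablesRel`, the difference `[r] − [r']` lies in the set-chain group
`closure ((domainAddRel ∪ changeOfVariablesRel) ∩ closure {[t] : t integrand 1 of dimension n})`:
`[r] − [r'] = ([r] − [s] − [N]) − ([r'] − [s'] − [N']) + ([s] − [s']) + [N] − [N']` with the null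
complements `N = r|(r ∖ s)`, `N' = r'|(r' ∖ s')`. [Kontsevich–Zagier 2001, §1.2] -/
theorem sub_mem_closure_of_transport {n : ℕ} (r r' s s' : KZ.IntegralRep n)
    (hr : ∀ p ∈ r.domain, r.integrand p = 1) (hr' : ∀ p ∈ r'.domain, r'.integrand p = 1)
    (hs : ∀ p ∈ s.domain, s.integrand p = 1) (hs' : ∀ p ∈ s'.domain, s'.integrand p = 1)
    (hsr : s.domain ⊆ r.domain) (hrs : volume (r.domain \ s.domain) = 0)
    (hsr' : s'.domain ⊆ r'.domain) (hrs' : volume (r'.domain \ s'.domain) = 0)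
    (hcov : KZ.of s - KZ.of s' ∈ KZ.changeOfVariablesRel) :
    KZ.of r - KZ.of r' ∈ AddSubgroup.closure ((KZ.domainAddRel ∪ KZ.changeOfVariablesRel) ∩
      (AddSubgroup.closure {x : KZ.FormalRep | ∃ t : KZ.IntegralRep n,
        (∀ p ∈ t.domain, t.integrand p = 1) ∧ x = KZ.of t} : Set KZ.FormalRep)) := by
  -- integrand-1 generators lie in the inner subgroup
  have memP : ∀ t : KZ.IntegralRep n, (∀ p ∈ t.domain, t.integrand p = 1) →
      KZ.of t ∈ AddSubgroup.closure {x : KZ.FormalRep | ∃ t : KZ.IntegralRep n,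
        (∀ p ∈ t.domain, t.integrand p = 1) ∧ x = KZ.of t} :=
    fun t ht => AddSubgroup.subset_closure ⟨t, ht, rfl⟩
  -- the null complements `N = r|(r ∖ s)` and `N' = r'|(r' ∖ s')`
  obtain ⟨N, hNd, hNi⟩ : ∃ N : KZ.IntegralRep n,
      N.domain = r.domain \ s.domain ∧ N.integrand = r.integrand :=
    ⟨r.restrict _ (r.isSemialgebraic_domain.diff s.isSemialgebraic_domain) Set.sdiff_subset,
      rfl, rfl⟩
  obtain ⟨N', hNd', hNi'⟩ : ∃ N' : KZ.IntegralRep n,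
      N'.domain = r'.domain \ s'.domain ∧ N'.integrand = r'.integrand :=
    ⟨r'.restrict _ (r'.isSemialgebraic_domain.diff s'.isSemialgebraic_domain) Set.sdiff_subset,
      rfl, rfl⟩
  have hN1 : ∀ p ∈ N.domain, N.integrand p = 1 := fun p hp => by
    rw [hNd] at hp
    rw [hNi]
    exact hr p hp.1
  have hN1' : ∀ p ∈ N'.domain, N'.integrand p = 1 := fun p hp => by
    rw [hNd'] at hp
    rw [hNi']
    exact hr' p hp.1
  -- the two splittings are move (1a)
  have h1 : KZ.of r - KZ.of s - KZ.of N ∈ KZ.domainAddRel :=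
    of_sub_of_sub_of_mem_domainAddRel r s N hsr (fun p hp => by rw [hr p (hsr hp), hs p hp]) hNd hNi
  have h1' : KZ.of r' - KZ.of s' - KZ.of N' ∈ KZ.domainAddRel :=
    of_sub_of_sub_of_mem_domainAddRel r' s' N' hsr' (fun p hp => by rw [hr' p (hsr' hp), hs' p hp])
      hNd' hNi'
  -- bookkeeping in the formal group
  have key : KZ.of r - KZ.of r' = (KZ.of r - KZ.of s - KZ.of N) - (KZ.of r' - KZ.of s' - KZ.of N')
      + (KZ.of s - KZ.of s') + KZ.of N - KZ.of N' := by abel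
  rw [key]
  refine AddSubgroup.sub_mem _ (AddSubgroup.add_mem _ (AddSubgroup.add_mem _
    (AddSubgroup.sub_mem _ ?_ ?_) ?_) ?_) ?_
  · exact AddSubgroup.subset_closure ⟨Or.inl h1,
      AddSubgroup.sub_mem _ (AddSubgroup.sub_mem _ (memP r hr) (memP s hs)) (memP N hN1)⟩
  · exact AddSubgroup.subset_closure ⟨Or.inl h1',
      AddSubgroup.sub_mem _ (AddSubgroup.sub_mem _ (memP r' hr') (memP s' hs')) (memP N' hN1')⟩
  · exact AddSubgroup.subset_closure ⟨Or.inr hcov, AddSubgroup.sub_mem _ (memP s hs) (memP s' hs')⟩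
  · exact of_mem_closure_of_volume_eq_zero N (by rw [hNd]; exact hrs) _ (memP N hN1)
  · exact of_mem_closure_of_volume_eq_zero N' (by rw [hNd']; exact hrs') _ (memP N' hN1')

/-- **`TransportToGroup`** (stmt-KontsevichZagierPeriods-9850, route SymplecticScissors): the
null-set bookkeeping PlanarTransport ⟹ PlanarK0Injective — for planar integrand-`1`
representations `r, r'` with full-measure integrand-`1` restrictions `s ⊆ r`, `s' ⊆ r'` such that
`[s] − [s']` is one change-of-variables generator, `[r] − [r']` lies in the planar set-chain group.
The dimension-`2` case of `sub_mem_closure_of_transport`. [Kontsevich–Zagier 2001, §1.2] -/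
theorem TransportToGroup_proof : TransportToGroup := by
  unfold TransportToGroup
  intro r r' s s' hr hr' hs hs' hsr hrs hsr' hrs' hcov
  exact sub_mem_closure_of_transport r r' s s' hr hr' hs hs' hsr hrs hsr' hrs' hcov

end Summit.KontsevichZagierPeriods.SymplecticScissors.TransportToGroup

end
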